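import Summits.BirchSwinnertonDyer.BirchSwinnertonDyer.Theorems.ByReductionTypeAtTwoRankOneSigmaHeightNeronDuplication
import HarnessLib

/-!
# Route `ByReductionTypeAtTwo`, crux `RankOneAtTwoBigImageOddLocal` (item stmt-BirchSwinnertonDyer-23715), line AN62, σ₀-LEMMA BLOCK
# (cell `bsd-f1-sign2`, planner seat `-an` g50; `--supports 23715`, helper):
# **NÉRON'S DUPLICATION DENOMINATOR: `den x(2P) = D(4a³ + b₂a²D + 2b₄aD² + b₆D³)` exactly for a point of non-singular reduction everywhere
# (the companion of `…SigmaHeightNeronDuplication`; together: Ayad's no-cancellation lemma at `m = 2`)**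

HONEST FRAMING (D-0036/D-0054): THEOREMS ONLY (no definition, no named fact, no `sorry`, no instance).  Same setting and proof skeleton as
`num_two_nsmul_eq_neronNumerator`: `x(2P) = N/M` with `N`, `M` coprime integers and `M = D⁴ψ₂² > 0`, so `den x(2P) = M`
(`den_two_nsmul_eq_neronDenominator`, `num_den_two_nsmul_eq`).  Census `ana/neron_all.py`: numerator AND denominator exact on 10 890/10 890 rows.
Nothing here is a statement about `BSDp`; item 23715 stays OPEN; BSD is proved for no curve.
References: [cite: SilvermanAEC2009, III.2.3(d), Ex. 3.7, VII.2].
-/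

set_option autoImplicit false

noncomputable section

open scoped Classical

open WeierstrassCurve Literature Literature.NumberTheory.EllipticCurves

namespace Summit.BirchSwinnertonDyer.BirchSwinnertonDyer.Theorems

namespace NaiveSigmaLogAtTwo

/-- **Néron's duplication denominator**: for a `ℤ`-integral equation `V/ℚ`, a rational point `P = (x, y)` with non-singular reduction at every
prime and `2P = (x′, y′)` affine, writing `x = a/D` in lowest terms, `den x′ = D(4a³ + b₂a²D + 2b₄aD² + b₆D³)` exactly.
[cite: SilvermanAEC2009, III.2.3(d), Ex. 3.7, VII.2] -/
theorem den_two_nsmul_eq_neronDenominator (V : WeierstrassCurve ℚ) [V.IsIntegral ℤ] {x y x' y' : ℚ}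
    (h : V.toAffine.Nonsingular x y) (h' : V.toAffine.Nonsingular x' y')
    (hns : ∀ ℓ : ℕ, ℓ.Prime → V.HasNonsingularReductionAt ℓ x y)
    (h2 : (2 : ℕ) • (.some x y h : V.toAffine.Point) = .some x' y' h') :
    (x'.den : ℚ) = (x.den : ℚ) * (4 * (x.num : ℚ) ^ 3 + V.b₂ * (x.num : ℚ) ^ 2 * (x.den : ℚ)
      + 2 * V.b₄ * (x.num : ℚ) * (x.den : ℚ) ^ 2 + V.b₆ * (x.den : ℚ) ^ 3) := by
  -- integer coefficients
  obtain ⟨A₁, hA1⟩ : ∃ A : ℤ, V.a₁ = A := ⟨(WeierstrassCurve.integralModel ℤ V).a₁, by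
    rw [← WeierstrassCurve.integralModel_a₁_eq ℤ V]; exact eq_intCast _ _⟩
  obtain ⟨A₂, hA2⟩ : ∃ A : ℤ, V.a₂ = A := ⟨(WeierstrassCurve.integralModel ℤ V).a₂, by
    rw [← WeierstrassCurve.integralModel_a₂_eq ℤ V]; exact eq_intCast _ _⟩
  obtain ⟨A₃, hA3⟩ : ∃ A : ℤ, V.a₃ = A := ⟨(WeierstrassCurve.integralModel ℤ V).a₃, by
    rw [← WeierstrassCurve.integralModel_a₃_eq ℤ V]; exact eq_intCast _ _⟩
  obtain ⟨A₄, hA4⟩ : ∃ A : ℤ, V.a₄ = A := ⟨(WeierstrassCurve.integralModel ℤ V).a₄, by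
    rw [← WeierstrassCurve.integralModel_a₄_eq ℤ V]; exact eq_intCast _ _⟩
  obtain ⟨A₆, hA6⟩ : ∃ A : ℤ, V.a₆ = A := ⟨(WeierstrassCurve.integralModel ℤ V).a₆, by
    rw [← WeierstrassCurve.integralModel_a₆_eq ℤ V]; exact eq_intCast _ _⟩
  have hb4 : V.b₄ = 2 * A₄ + A₁ * A₃ := by rw [WeierstrassCurve.b₄, hA1, hA3, hA4]
  have hb6 : V.b₆ = A₃ ^ 2 + 4 * A₆ := by rw [WeierstrassCurve.b₆, hA3, hA6]
  have hb8 : V.b₈ = A₁ ^ 2 * A₆ + 4 * A₂ * A₆ - A₁ * A₃ * A₄ + A₂ * A₃ ^ 2 - A₄ ^ 2 := by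
    rw [WeierstrassCurve.b₈, hA1, hA2, hA3, hA4, hA6]
  -- `P ≠ -P` and the duplication formula
  have hy : y ≠ V.toAffine.negY x y := by
    intro hyeq
    rw [two_nsmul, WeierstrassCurve.Affine.Point.add_self_of_Y_eq hyeq] at h2
    cases h2
  have hψ0 : 2 * y + V.a₁ * x + V.a₃ ≠ 0 := by
    intro h0; apply hy; rw [WeierstrassCurve.Affine.negY]; linear_combination h0
  rw [two_nsmul, WeierstrassCurve.Affine.Point.add_self_of_Y_ne hy] at h2
  simp only [WeierstrassCurve.Affine.Point.some.injEq] at h2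
  have hx' : x' = (x ^ 4 - V.b₄ * x ^ 2 - 2 * V.b₆ * x - V.b₈) / (2 * y + V.a₁ * x + V.a₃) ^ 2 := by
    rw [← h2.1]; exact addX_self_eq_div V.toAffine h.left hy
  -- the integers `N`, `M`
  have ha : (x.num : ℚ) = x * (x.den : ℚ) := (Rat.mul_den_eq_num x).symm
  have hD0 : (x.den : ℚ) ≠ 0 := Nat.cast_ne_zero.mpr x.den_nz
  obtain ⟨N, hNdef⟩ : ∃ N : ℤ, N = x.num ^ 4 - (2 * A₄ + A₁ * A₃) * x.num ^ 2 * (x.den : ℤ) ^ 2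
      - 2 * (A₃ ^ 2 + 4 * A₆) * x.num * (x.den : ℤ) ^ 3
      - (A₁ ^ 2 * A₆ + 4 * A₂ * A₆ - A₁ * A₃ * A₄ + A₂ * A₃ ^ 2 - A₄ ^ 2) * (x.den : ℤ) ^ 4 := ⟨_, rfl⟩
  obtain ⟨M, hMdef⟩ : ∃ M : ℤ, M = (x.den : ℤ) * (4 * x.num ^ 3 + (A₁ ^ 2 + 4 * A₂) * x.num ^ 2 * x.den
      + 2 * (2 * A₄ + A₁ * A₃) * x.num * (x.den : ℤ) ^ 2 + (A₃ ^ 2 + 4 * A₆) * (x.den : ℤ) ^ 3) := ⟨_, rfl⟩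
  have hN : (N : ℚ) = (x.den : ℚ) ^ 4 * (x ^ 4 - (2 * A₄ + A₁ * A₃) * x ^ 2 - 2 * (A₃ ^ 2 + 4 * A₆) * x
      - (A₁ ^ 2 * A₆ + 4 * A₂ * A₆ - A₁ * A₃ * A₄ + A₂ * A₃ ^ 2 - A₄ ^ 2)) := by
    rw [hNdef]; push_cast; rw [ha]; ring
  have hM : (M : ℚ) = (x.den : ℚ) ^ 4 * (2 * y + A₁ * x + A₃) ^ 2 := by
    have e := psiTwo_sq_eq V.toAffine h.left
    rw [hA1, hA3] at e
    have e' : ((2 : ℚ) * y + A₁ * x + A₃) ^ 2 = 4 * x ^ 3 + V.b₂ * x ^ 2 + 2 * V.b₄ * x + V.b₆ := e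
    rw [e', WeierstrassCurve.b₂, hb4, hb6, hA1, hA2, hMdef]; push_cast; rw [ha]; ring
  -- `x' = N / M`
  have hx'NM : x' = (N : ℚ) / (M : ℚ) := by
    rw [hx', hN, hM, hb4, hb6, hb8, hA1, hA3, mul_div_mul_left _ _ (pow_ne_zero 4 hD0)]
  -- `M > 0`
  have hM0 : 0 < M := by
    have hψ0' : (2 : ℚ) * y + A₁ * x + A₃ ≠ 0 := by rw [hA1, hA3] at hψ0; exact_mod_cast hψ0
    have : (0 : ℚ) < (M : ℚ) := by
      rw [hM]
      exact mul_pos (pow_pos (Nat.cast_pos.mpr x.den_pos) 4)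
        (lt_of_le_of_ne (sq_nonneg _) (Ne.symm (pow_ne_zero 2 hψ0')))
    exact_mod_cast this
  -- `gcd(N, M) = 1`
  have hcop : Nat.Coprime N.natAbs M.natAbs := by
    refine Nat.coprime_of_dvd fun k hk hkN hkM => ?_
    haveI : Fact k.Prime := ⟨hk⟩
    exact not_dvd_of_hasNonsingularReductionAt V hA1 hA2 hA3 hA4 hA6 h (hns k hk) hN hM
      (Int.ofNat_dvd_left.mpr hkN) (Int.ofNat_dvd_left.mpr hkM)
  -- conclude
  have hden : (x'.den : ℤ) = M := by rw [hx'NM]; exact Rat.den_div_eq_of_coprime hM0 hcop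
  have hden' : (x'.den : ℚ) = (M : ℚ) := by exact_mod_cast hden
  rw [hden', hMdef, WeierstrassCurve.b₂, hb4, hb6, hA1, hA2]
  push_cast
  ring

/-- **Corollary (both sides, Ayad's lemma at `m = 2`)**: `x(2P) = N/M` with `N = a⁴ − b₄a²D² − 2b₆aD³ − b₈D⁴`, `M = D(4a³ + b₂a²D + 2b₄aD² + b₆D³)`
coprime and `M > 0`: `num x(2P) = N ∧ den x(2P) = M`. [cite: SilvermanAEC2009, III.2.3(d), Ex. 3.7, VII.2] -/
theorem num_den_two_nsmul_eq (V : WeierstrassCurve ℚ) [V.IsIntegral ℤ] {x y x' y' : ℚ}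
    (h : V.toAffine.Nonsingular x y) (h' : V.toAffine.Nonsingular x' y')
    (hns : ∀ ℓ : ℕ, ℓ.Prime → V.HasNonsingularReductionAt ℓ x y)
    (h2 : (2 : ℕ) • (.some x y h : V.toAffine.Point) = .some x' y' h') :
    (x'.num : ℚ) = (x.num : ℚ) ^ 4 - V.b₄ * (x.num : ℚ) ^ 2 * (x.den : ℚ) ^ 2
        - 2 * V.b₆ * (x.num : ℚ) * (x.den : ℚ) ^ 3 - V.b₈ * (x.den : ℚ) ^ 4 ∧
      (x'.den : ℚ) = (x.den : ℚ) * (4 * (x.num : ℚ) ^ 3 + V.b₂ * (x.num : ℚ) ^ 2 * (x.den : ℚ)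
        + 2 * V.b₄ * (x.num : ℚ) * (x.den : ℚ) ^ 2 + V.b₆ * (x.den : ℚ) ^ 3) :=
  ⟨num_two_nsmul_eq_neronNumerator V h h' hns h2, den_two_nsmul_eq_neronDenominator V h h' hns h2⟩

end NaiveSigmaLogAtTwo

end Summit.BirchSwinnertonDyer.BirchSwinnertonDyer.Theorems
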